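import Literature.NumberTheory.Automorphic.HeckeSeriesCosetCount
import Literature.NumberTheory.Automorphic.GJUnfoldingLocal
import Literature.NumberTheory.Automorphic.GodementJacquetPartialLProofs
import HarnessLib

/-!
# The Hecke bound `|a| ≤ q_v^{(n-1)/2}` on the Hecke–Satake parameters of cuspidal representations

Topic `NumberTheory/Automorphic`; theorems only (no definition, no named fact). Companion to
`SatakeParameterTrivialBound` (the crude bound `|a| ≤ q_v^{n²} + 1` from the size of the double
cosets), `SatakeParameterUnitBound` (`|a| = 1` for `n ≤ 1`), `SatakeParameterRankTwoBound`
(`|a| ≤ q_v^{1/2}` for `n ≤ 2`), `SatakeParameterGenericBound`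
(Jacquet–Shalika's `|a| < q_v^{1/2}` from genericity, as named facts) and
`GodementJacquetPartialLProofs` (the reductions of the named fact
`JacquetShalika1981_differentiableOn_partialStandardL`, Jacquet–Shalika (1981), Thm. (5.3)).

## Main statements (all proved, from the tree's `L²`/Hecke-operator definitions)

* `norm_le_sqrt_pow_of_hasSatakeParameterAt`, `IsSatakeFamilyOf.norm_le_sqrt_pow`,
  `IsSatakeFamilyOf.norm_le_rpow_sub_one_div_two` (**the Hecke bound**): every Hecke–Satake
  parameter `a` of a cuspidal automorphic representation `Π ≤ L²(GL_n(K) A_G \ GL_n(𝔸_K))` at an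
  unramified finite place `v` satisfies `|a| ≤ q_v^{(n-1)/2}`. Proof: by Tamagawa's identity in
  Satake form (`exists_heckeDetEigenvalues_rightRegularLocal` of `GJUnfoldingLocal`) the
  eigenvalues `r_m` of the operators `T(ϖ^m)` on the spherical vectors of `Π` at `v` satisfy
  `(∑_m r_m X^m) ∏_{b ∈ α}(1 - q_v^{(n-1)/2} b X) = 1`, and `|r_m| ≤ #(Δ_m K/K)` because the
  regular representation is unitary; the coset-counting series has radius of convergence
  `q_v^{-(n-1)}` (`summable_ncard_cosets_glIntDet_mul_pow` of `HeckeSeriesCosetCount`), so the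
  identity holds analytically on `|X| < q_v^{-(n-1)}` (`tsum_mul_eval_eq_one_of_summable`) and the
  Euler polynomial has no zero `X = q_v^{-(n-1)/2} b⁻¹` there. This is the bound valid for all
  irreducible unitary spherical representations of `GL_n` (sharp: the trivial representation has
  parameters `q^{(n-1)/2}, …, q^{-(n-1)/2}`), obtained here without any local representation
  theory.
* For `n ≤ 2` the Hecke bound *is* Jacquet–Shalika's (5.1.3) `|a| ≤ q_v^{1/2}`; that case of the
  named fact `norm_satakeParameter_le_sqrt` is proved independently (by the unitarity symmetry of
  the two parameters) in `SatakeParameterRankTwoBound`, and is not restated here.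
* `IsSatakeFamilyOf.norm_le_residueCard_of_le_three` and
  `JacquetShalika1981_differentiableOn_partialStandardL_of_lemma52_of_le_three`: for `n ≤ 3` the
  Hecke bound gives the weak local input `|a| ≤ q_v` of
  `JacquetShalika1981_differentiableOn_partialStandardL_of_lemma52_of_norm_le`, so in rank `≤ 3`
  the named fact `JacquetShalika1981_differentiableOn_partialStandardL` (holomorphy of `L^S(s, Π)` on
  `re s > 1`) follows from Lemma (5.2) (`JacquetShalika1981_continuation_partialPairL_conj`) alone —
  no Cor. (2.5), no genericity of local components. (For `n ≥ 4` the weak bound genuinely needs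
  genericity: the trivial representation of `GL_4(F)` is unitary and unramified with parameter
  `q^{3/2} > q`.)
* `differentiableOn_partialStandardL_of_norm_le_rpow`, `differentiableOn_partialStandardL_of_half_lt_re`:
  `L^S(s, Π)` is holomorphic and non-zero on `re s > (n+1)/2` for every cuspidal `Π` on `GL_n`,
  `n ≥ 1`, unconditionally (the abscissa `n² + 2` of `differentiableOn_partialStandardL_of_lt_re`
  improved by the Hecke bound).

## References

* H. Jacquet, J. A. Shalika, *On Euler products and the classification of automorphic
  representations I*, Amer. J. Math. 103 (1981), 499–558: Thm. (5.3), Lemma (5.2), Remark (5.4),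
  (5.1.3), Cor. (2.5) [JacquetShalikaAJM1981].
* G. Shimura, *Introduction to the arithmetic theory of automorphic functions* (1971), §3.2,
  Thm. 3.21 (Tamagawa's rationality theorem) [ShimuraIATAF1971].
* P. Sarnak, *Notes on the generalized Ramanujan conjectures*, Clay Math. Proc. 4 (2005), §1
  (the bounds towards Ramanujan for `GL_n`; the trivial bound from the unitary dual).
-/

noncomputable section

open Finset

namespace Literature.NumberTheory.Automorphic

/-! ### From the formal to the analytic Hecke series, under absolute convergence -/

section Analytic

open Polynomial

/-- **From the formal to the analytic Hecke series** (variant of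
`tsum_mul_eval_eq_one_of_mk_mul_eq_one` of `HeckeSeriesConvergence` with the absolute convergence
as the hypothesis instead of a geometric bound): if `(∑ r_m X^m) · P = 1` in `ℂ⟦X⟧` for a polynomial
`P` and `∑_m ‖r_m x^m‖ < ∞`, then `(∑' r_m x^m) · P(x) = 1` (Cauchy product). [folklore] -/
theorem tsum_mul_eval_eq_one_of_summable {r : ℕ → ℂ} {P : ℂ[X]}
    (h : PowerSeries.mk r * (P : PowerSeries ℂ) = 1) {x : ℂ}
    (hsum : Summable fun m => ‖r m * x ^ m‖) :
    (∑' m, r m * x ^ m) * P.eval x = 1 := by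
  classical
  -- the polynomial as a finitely supported series
  set b : ℕ → ℂ := fun i => P.coeff i * x ^ i with hb
  have hbsupp : ∀ i ∉ Finset.range (P.natDegree + 1), b i = 0 := by
    intro i hi
    rw [Finset.mem_range, not_lt] at hi
    simp [hb, Polynomial.coeff_eq_zero_of_natDegree_lt hi]
  have hbsum : Summable fun i => ‖b i‖ := by
    apply summable_of_ne_finset_zero (s := Finset.range (P.natDegree + 1))
    intro i hi
    rw [hbsupp i hi, norm_zero]
  have heval : P.eval x = ∑' i, b i := by
    rw [tsum_eq_sum (s := Finset.range (P.natDegree + 1)) (fun i hi => hbsupp i hi),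
      Polynomial.eval_eq_sum_range]
  rw [heval, tsum_mul_tsum_eq_tsum_sum_antidiagonal_of_summable_norm hsum hbsum]
  -- the `N`-th Cauchy coefficient is `x^N · coeff_N (mk r * P) = [N = 0]`
  have hcoef : ∀ N : ℕ, ∑ p ∈ Finset.HasAntidiagonal.antidiagonal N, r p.1 * x ^ p.1 * b p.2 =
      if N = 0 then (1 : ℂ) else 0 := by
    intro N
    have hN := congrArg (PowerSeries.coeff N) h
    rw [PowerSeries.coeff_mul, PowerSeries.coeff_one] at hN
    simp only [PowerSeries.coeff_mk, Polynomial.coeff_coe] at hN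
    calc ∑ p ∈ Finset.HasAntidiagonal.antidiagonal N, r p.1 * x ^ p.1 * b p.2
        = (∑ p ∈ Finset.HasAntidiagonal.antidiagonal N, r p.1 * P.coeff p.2) * x ^ N := by
          rw [Finset.sum_mul]
          refine Finset.sum_congr rfl fun p hp => ?_
          have hp' : p.1 + p.2 = N := Finset.HasAntidiagonal.mem_antidiagonal.mp hp
          simp only [hb]
          rw [← hp', pow_add]
          ring
      _ = if N = 0 then (1 : ℂ) else 0 := by
          rw [hN]
          split_ifs with h0
          · rw [h0, pow_zero, mul_one]
          · rw [zero_mul]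
  simp_rw [hcoef]
  rw [tsum_ite_eq 0 (fun _ => (1 : ℂ))]

end Analytic

/-! ### The Hecke bound on the Hecke–Satake parameters of a cuspidal representation -/

section Global

open NumberField IsDedekindDomain MeasureTheory ValuativeRel

variable {n : ℕ} {K : Type} [Field K] [NumberField K]
  {μ : Measure (AdelicGroupData.gl n K).automorphicQuotient}
  [(AdelicGroupData.gl n K).IsAutomorphicMeasure μ]

/-- **The Hecke bound `|a| ≤ q_w^{(n-1)/2}` on Hecke–Satake parameters of cuspidal representations.**
Let `Π ≤ L²(GL_n(K) A_G \ GL_n(𝔸_K))` be a cuspidal automorphic representation with Satake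
parameter `α` at the finite place `w` (`HasSatakeParameterAt` with respect to `K(𝔫)`, `w ∤ 𝔫 ≠ 0`).
Then every `a ∈ α` satisfies `‖a‖ ≤ q_w^{(n-1)/2}`. Proof: the operators `T(ϖ^m)` act on the
spherical vectors `Π^{GL_n(𝒪_w)} ⊂ L²` by scalars `r_m` with
`(∑ r_m X^m) ∏_{b ∈ α} (1 - q_w^{(n-1)/2} b X) = 1` (Tamagawa's identity in Satake form,
`exists_heckeDetEigenvalues_rightRegularLocal`) and `|r_m| ≤ #(Δ_m K/K)` (`R` is unitary); since
`∑_m #(Δ_m K/K) t^m < ∞` for `q_w^{n-1} t < 1` (`summable_ncard_cosets_glIntDet_mul_pow`), the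
identity holds analytically on `|X| < q_w^{-(n-1)}`, where the Euler polynomial therefore has no
zero; its zeros are `X = q_w^{-(n-1)/2} b⁻¹`, `b ∈ α`, whence `q_w^{-(n-1)/2} |a|⁻¹ ≥ q_w^{-(n-1)}`.
This is the bound satisfied by every irreducible unitary spherical representation of `GL_n`
(attained by the trivial representation, parameters `q^{±(n-1)/2}, …`); it improves the crude
bound `IsSatakeFamilyOf.norm_le` (`q_w^{n²} + 1`) and, for `n ≤ 3`, supplies the local input
`‖a‖ ≤ q_w` of `JacquetShalika1981_differentiableOn_partialStandardL_of_lemma52_of_norm_le`.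
[folklore] -/
theorem norm_le_sqrt_pow_of_hasSatakeParameterAt (P : CuspidalAutomorphicRepGL n K μ)
    {w : HeightOneSpectrum (𝓞 K)} {𝔫 : Ideal (𝓞 K)} (h𝔫 : 𝔫 ≠ 0) (hw : ¬ w.asIdeal ∣ 𝔫)
    {ϖ : (w.adicCompletion K)ˣ} {α : Multiset ℂ}
    (hα : HasSatakeParameterAt P.1 (principalCongruenceLevel n K 𝔫) w ϖ α) {a : ℂ} (ha : a ∈ α) :
    ‖a‖ ≤ Real.sqrt (w.residueCard : ℝ) ^ (n - 1) := by
  have hϖ : IsUniformizingElement (ϖ : w.adicCompletion K) :=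
    isUniformizingElement_of_valued_eq K w hα.1
  have hq : Nat.card 𝓀[w.adicCompletion K] = w.residueCard :=
    natCard_valuativeResidueField_adicCompletion_eq K w
  obtain ⟨r, hr, hmk, -, -⟩ := exists_heckeDetEigenvalues_rightRegularLocal P h𝔫 hw hα hϖ
  -- the Satake eigenvector, read in `L²`: a non-zero spherical vector at `w`
  obtain ⟨-, -, f, hf, hf0, -⟩ := hα
  have hfK : ∀ k ∈ principalCongruenceLevel n K 𝔫,
      (AdelicGroupData.gl n K).rightRegular μ k (f : (AdelicGroupData.gl n K).L2 μ) = f := by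
    intro k hk
    exact congrArg Subtype.val ((ContRepresentation.ClosedSubrep.mem_fixedVectors _ _ _).1 hf k hk)
  have hfsph : (f : (AdelicGroupData.gl n K).L2 μ) ∈ sphericalVectorsAt μ P w := by
    refine mem_sphericalVectorsAt_iff.2 ⟨f.2, fun k hk => hfK _ ?_⟩
    refine isMaximalAt_principalCongruenceLevel n K w h𝔫 hw ⟨k, ?_, rfl⟩
    rwa [← glInt_adicCompletion_eq]
  have hf0' : (f : (AdelicGroupData.gl n K).L2 μ) ≠ 0 := fun h => hf0 (Subtype.ext h)
  -- `|r_m| ≤ #(Δ_m K / K)` by unitarity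
  have hrD : ∀ m, ‖r m‖ ≤ ({γ : GL (Fin n) (w.adicCompletion K) ⧸ glInt n (w.adicCompletion K) |
      γ.out ∈ glIntDet n (ϖ : w.adicCompletion K) m}.ncard : ℝ) := fun m => by
    have h := norm_heckeDetOperator_rightRegularLocal_le (μ := μ) w hϖ m
      (f : (AdelicGroupData.gl n K).L2 μ)
    rw [hr m _ hfsph, norm_smul, ← Set.ncard_eq_toFinset_card _ (finite_cosets_glIntDet hϖ m)] at h
    exact le_of_mul_le_mul_right h (norm_pos_iff.2 hf0')
  -- suppose the bound fails at `a`, and evaluate at the zero `x = (q^{(n-1)/2} a)⁻¹`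
  by_contra hlt
  rw [not_le] at hlt
  set c : ℝ := Real.sqrt (w.residueCard : ℝ) ^ (n - 1) with hc
  have hq1 : (1 : ℝ) < w.residueCard := by exact_mod_cast w.one_lt_residueCard
  have hc0 : 0 < c := pow_pos (Real.sqrt_pos.2 (zero_lt_one.trans hq1)) _
  have ha0 : 0 < ‖a‖ := hc0.trans hlt
  set x : ℂ := ((((Real.sqrt (w.residueCard : ℝ) : ℝ) : ℂ) ^ (n - 1)) * a)⁻¹ with hx
  have hca : ‖((Real.sqrt (w.residueCard : ℝ) : ℝ) : ℂ) ^ (n - 1) * a‖ = c * ‖a‖ := by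
    rw [norm_mul, norm_pow, Complex.norm_real, Real.norm_of_nonneg (Real.sqrt_nonneg _)]
  have hca0 : (((Real.sqrt (w.residueCard : ℝ) : ℝ) : ℂ) ^ (n - 1)) * a ≠ 0 := by
    rw [← norm_pos_iff, hca]
    exact mul_pos hc0 ha0
  have hxnorm : ‖x‖ = (c * ‖a‖)⁻¹ := by rw [hx, norm_inv, hca]
  -- `q^{n-1} ‖x‖ = c / ‖a‖ < 1`
  have hxlt : (Nat.card 𝓀[w.adicCompletion K] : ℝ) ^ (n - 1) * ‖x‖ < 1 := by
    have hqc : (w.residueCard : ℝ) ^ (n - 1) = c * c := by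
      rw [hc, ← mul_pow, Real.mul_self_sqrt (Nat.cast_nonneg _)]
    rw [hq, hqc, hxnorm, mul_inv, ← mul_assoc, mul_assoc c c, mul_inv_cancel₀ hc0.ne', mul_one,
      ← div_eq_mul_inv, div_lt_one ha0]
    exact hlt
  -- hence `∑ ‖r_m x^m‖ < ∞` and the analytic identity `(∑' r_m x^m) P_α(x) = 1`
  have hsD := summable_ncard_cosets_glIntDet_mul_pow (n := n) hϖ (norm_nonneg x) hxlt
  have hsum : Summable fun m => ‖r m * x ^ m‖ := by
    refine Summable.of_nonneg_of_le (fun m => norm_nonneg _) (fun m => ?_) hsD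
    rw [norm_mul, norm_pow]
    exact mul_le_mul_of_nonneg_right (hrD m) (pow_nonneg (norm_nonneg x) m)
  have h1 := tsum_mul_eval_eq_one_of_summable hmk hsum
  -- but `P_α(x) = 0`
  have h0 : ((α.map fun b => (1 : Polynomial ℂ) -
      Polynomial.C ((((Real.sqrt (w.residueCard : ℝ)) : ℝ) : ℂ) ^ (n - 1) * b) * Polynomial.X).prod).eval
        x = 0 := by
    rw [Polynomial.eval_multiset_prod, Multiset.prod_eq_zero_iff, Multiset.map_map]
    refine Multiset.mem_map.2 ⟨a, ha, ?_⟩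
    simp only [Function.comp_apply, Polynomial.eval_sub, Polynomial.eval_one, Polynomial.eval_mul,
      Polynomial.eval_C, Polynomial.eval_X]
    rw [hx, mul_inv_cancel₀ hca0, sub_self]
  rw [h0, mul_zero] at h1
  exact zero_ne_one h1

/-- **The Hecke bound for Satake families:** for a Satake family `α` of a cuspidal automorphic
representation `Π` of `GL_n(𝔸_K)` away from `S` (`IsSatakeFamilyOf`), every `a ∈ α v`, `v ∉ S`,
satisfies `‖a‖ ≤ q_v^{(n-1)/2}` (`norm_le_sqrt_pow_of_hasSatakeParameterAt`). [folklore] -/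
theorem IsSatakeFamilyOf.norm_le_sqrt_pow {P : CuspidalAutomorphicRepGL n K μ}
    {S : Set (HeightOneSpectrum (𝓞 K))} {α : SatakeFamily K} (hα : IsSatakeFamilyOf P S α)
    {v : HeightOneSpectrum (𝓞 K)} (hv : v ∉ S) {a : ℂ} (ha : a ∈ α v) :
    ‖a‖ ≤ Real.sqrt (v.residueCard : ℝ) ^ (n - 1) := by
  obtain ⟨𝔫, h𝔫, hv𝔫, ϖ, hsat⟩ := hα v hv
  exact norm_le_sqrt_pow_of_hasSatakeParameterAt P h𝔫 hv𝔫 hsat ha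

/-- The Hecke bound with a real exponent: `‖a‖ ≤ q_v^{((n : ℝ) - 1)/2}` for `n ≥ 1`. [folklore] -/
theorem IsSatakeFamilyOf.norm_le_rpow_sub_one_div_two {P : CuspidalAutomorphicRepGL n K μ}
    {S : Set (HeightOneSpectrum (𝓞 K))} {α : SatakeFamily K} (hα : IsSatakeFamilyOf P S α)
    (hn : 1 ≤ n) {v : HeightOneSpectrum (𝓞 K)} (hv : v ∉ S) {a : ℂ} (ha : a ∈ α v) :
    ‖a‖ ≤ (v.residueCard : ℝ) ^ (((n : ℝ) - 1) / 2) := by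
  refine (hα.norm_le_sqrt_pow hv ha).trans_eq ?_
  rw [Real.sqrt_eq_rpow, ← Real.rpow_natCast, ← Real.rpow_mul (Nat.cast_nonneg _), Nat.cast_sub hn,
    Nat.cast_one]
  ring_nf

/-- **The weak local bound `‖a‖ ≤ q_v` holds unconditionally in rank `n ≤ 3`**
(`q_v^{(n-1)/2} ≤ q_v`): no local factor `(1 - a q_v^{-s})⁻¹` of a cuspidal automorphic
representation of `GL_n(𝔸_K)`, `n ≤ 3`, at an unramified place has a pole on `re s > 1`. [folklore] -/
theorem IsSatakeFamilyOf.norm_le_residueCard_of_le_three (hn : n ≤ 3)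
    {P : CuspidalAutomorphicRepGL n K μ} {S : Set (HeightOneSpectrum (𝓞 K))} {α : SatakeFamily K}
    (hα : IsSatakeFamilyOf P S α) {v : HeightOneSpectrum (𝓞 K)} (hv : v ∉ S) {a : ℂ}
    (ha : a ∈ α v) : ‖a‖ ≤ (v.residueCard : ℝ) := by
  refine (hα.norm_le_sqrt_pow hv ha).trans ?_
  have h1 : (1 : ℝ) ≤ Real.sqrt (v.residueCard : ℝ) :=
    Real.one_le_sqrt.2 (by exact_mod_cast v.one_lt_residueCard.le)
  calc Real.sqrt (v.residueCard : ℝ) ^ (n - 1) ≤ Real.sqrt (v.residueCard : ℝ) ^ 2 :=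
        pow_le_pow_right₀ h1 (by omega)
    _ = (v.residueCard : ℝ) := Real.sq_sqrt (Nat.cast_nonneg _)

/-- **Jacquet–Shalika's Thm. (5.3) (`π' = 1`) from Lemma (5.2) alone, in rank `n ≤ 3`.** For
cuspidal automorphic representations of `GL_n(𝔸_K)`, `n ≤ 3`, the holomorphy of every partial
standard Euler product `L^S(s, Π)` on `re s > 1`
(`JacquetShalika1981_differentiableOn_partialStandardL`) follows from the continuation of
`L_S(s, π × π̄)` to `re s > 1` for the large finite sets `S` of Lemma (5.2)
(`JacquetShalika1981_continuation_partialPairL_conj`) — the local input of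
`JacquetShalika1981_differentiableOn_partialStandardL_of_lemma52_of_norm_le` at the finitely many
unramified places inside the exceptional set of the lemma being supplied by the Hecke bound
(`IsSatakeFamilyOf.norm_le_residueCard_of_le_three`), with no appeal to Cor. (2.5) / (5.1.3) or
to the genericity of local components. [cite: JacquetShalikaAJM1981, Thm. (5.3), Lemma (5.2), Remark (5.4)] -/
theorem JacquetShalika1981_differentiableOn_partialStandardL_of_lemma52_of_le_three (hn : n ≤ 3)
    (h₅₂ : JacquetShalika1981_continuation_partialPairL_conj (μ := μ)) :
    JacquetShalika1981_differentiableOn_partialStandardL (μ := μ) :=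
  JacquetShalika1981_differentiableOn_partialStandardL_of_lemma52_of_norm_le
    (fun _ _ _ hα _ hv _ ha => hα.norm_le_residueCard_of_le_three hn hv ha) h₅₂

end Global

/-! ### Holomorphy of `L^S(s, Π)` on `re s > (n+1)/2`, unconditionally -/

section Abscissa

open NumberField IsDedekindDomain MeasureTheory Complex

variable {K : Type} [Field K] [NumberField K]

/-- **Holomorphy and non-vanishing of a partial standard Euler product on `re s > B + 1` under a
bound `‖a‖ ≤ q_v^B`** on the parameters (`v ∉ S`, `card (α v) ≤ n`): on `re s > σ₁ > B + 1`,
`‖∏_{a ∈ α v}(1 - a q_v^{-s}) - 1‖ ≤ (2^n - 1) q_v^{B - σ₁}`, summable over `v`, and no factor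
vanishes, so `differentiableOn_partialStandardL_of_norm_sub_one_le` applies on every such
half-plane (the argument of `differentiableOn_partialStandardL_of_lt_re` of `GodementJacquetPartialL`
with a general exponent). [folklore] -/
theorem differentiableOn_partialStandardL_of_norm_le_rpow {S : Set (HeightOneSpectrum (𝓞 K))}
    {α : SatakeFamily K} {B : ℝ} {n : ℕ} (hcard : ∀ v ∉ S, Multiset.card (α v) ≤ n)
    (hαB : ∀ v ∉ S, ∀ a ∈ α v, ‖a‖ ≤ (v.residueCard : ℝ) ^ B) :
    DifferentiableOn ℂ (partialStandardL S α) {s : ℂ | B + 1 < s.re} ∧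
      ∀ s : ℂ, B + 1 < s.re → partialStandardL S α s ≠ 0 := by
  -- the estimate on `re s > σ₁`, for any `σ₁ > B + 1`
  have key : ∀ σ₁ : ℝ, B + 1 < σ₁ →
      DifferentiableOn ℂ (partialStandardL S α) {s : ℂ | σ₁ < s.re} ∧
        ∀ s : ℂ, σ₁ < s.re → partialStandardL S α s ≠ 0 := by
    intro σ₁ hσ₁
    have ht1 : 1 < σ₁ - B := by linarith
    refine differentiableOn_partialStandardL_of_norm_sub_one_le
      (u := fun v => (2 ^ n - 1) * (v.1.residueCard : ℝ) ^ (-(σ₁ - B)))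
      (((summable_residueCard_rpow_neg ht1).subtype _).mul_left (2 ^ n - 1))
      (fun v s hs => ?_) (fun v s hs => ?_)
    · have hs' : σ₁ < s.re := hs
      have hq1 : (1 : ℝ) < v.1.residueCard := by exact_mod_cast v.1.one_lt_residueCard
      have hq0 : (0 : ℝ) < v.1.residueCard := zero_lt_one.trans hq1
      have hx : ‖(v.1.residueCard : ℂ) ^ (-s)‖ ≤ (v.1.residueCard : ℝ) ^ (-s.re) := by
        rw [norm_natCast_cpow_of_pos (zero_lt_one.trans v.1.one_lt_residueCard), neg_re]
      have hprod : (v.1.residueCard : ℝ) ^ B * (v.1.residueCard : ℝ) ^ (-s.re) =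
          (v.1.residueCard : ℝ) ^ (-(s.re - B)) := by
        rw [← Real.rpow_add hq0]
        congr 1
        ring
      have hBt : (v.1.residueCard : ℝ) ^ B * (v.1.residueCard : ℝ) ^ (-s.re) ≤ 1 := by
        rw [hprod]
        exact Real.rpow_le_one_of_one_le_of_nonpos hq1.le (by linarith)
      have hB0 : 0 ≤ (v.1.residueCard : ℝ) ^ B := Real.rpow_nonneg hq0.le B
      obtain ⟨h1, -⟩ := norm_eval_eulerPolynomial_sub_one_le hB0 hx hBt (α v.1)
        (fun a ha => hαB v.1 v.2 a ha)
      refine h1.trans ?_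
      rw [hprod]
      have h2n : (0 : ℝ) ≤ 2 ^ n - 1 := sub_nonneg.mpr (one_le_pow₀ (by norm_num))
      have h2c : (2 : ℝ) ^ Multiset.card (α v.1) - 1 ≤ 2 ^ n - 1 :=
        sub_le_sub_right (pow_le_pow_right₀ (by norm_num) (hcard v.1 v.2)) 1
      calc (2 ^ Multiset.card (α v.1) - 1) * (v.1.residueCard : ℝ) ^ (-(s.re - B))
          ≤ (2 ^ n - 1) * (v.1.residueCard : ℝ) ^ (-(s.re - B)) :=
            mul_le_mul_of_nonneg_right h2c (Real.rpow_nonneg hq0.le _)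
        _ ≤ (2 ^ n - 1) * (v.1.residueCard : ℝ) ^ (-(σ₁ - B)) := by
            refine mul_le_mul_of_nonneg_left ?_ h2n
            exact Real.rpow_le_rpow_of_exponent_le hq1.le (by linarith)
    · -- no factor vanishes: `‖a q_v^{-s}‖ ≤ q_v^{B - re s} < 1`
      have hs' : σ₁ < s.re := hs
      have hq1 : (1 : ℝ) < v.1.residueCard := by exact_mod_cast v.1.one_lt_residueCard
      have hq0 : (0 : ℝ) < v.1.residueCard := zero_lt_one.trans hq1
      refine eval_eulerPolynomial_ne_zero_of_norm_mul_lt_one fun a ha => ?_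
      rw [norm_mul, norm_natCast_cpow_of_pos (zero_lt_one.trans v.1.one_lt_residueCard), neg_re]
      calc ‖a‖ * (v.1.residueCard : ℝ) ^ (-s.re)
          ≤ (v.1.residueCard : ℝ) ^ B * (v.1.residueCard : ℝ) ^ (-s.re) := by
            gcongr
            exact hαB v.1 v.2 a ha
        _ = (v.1.residueCard : ℝ) ^ (B - s.re) := by
            rw [← Real.rpow_add hq0]
            ring_nf
        _ < 1 := Real.rpow_lt_one_of_one_lt_of_neg hq1 (by linarith)
  refine ⟨differentiableOn_halfPlane_of_forall_lt fun σ₁ hσ₁ => (key σ₁ hσ₁).1, fun s hs => ?_⟩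
  have h₁ : B + 1 < (B + 1 + s.re) / 2 := by linarith
  have h₂ : (B + 1 + s.re) / 2 < s.re := by linarith
  exact (key _ h₁).2 s h₂

variable {n : ℕ} {μ : Measure (AdelicGroupData.gl n K).automorphicQuotient}
  [(AdelicGroupData.gl n K).IsAutomorphicMeasure μ]

/-- **The partial standard Euler product of a cuspidal `Π` on `GL_n`, `n ≥ 1`, is holomorphic and
non-zero on `re s > (n+1)/2`, unconditionally** (Hecke bound `‖a‖ ≤ q_v^{(n-1)/2}`,
`IsSatakeFamilyOf.norm_le_rpow_sub_one_div_two`, in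
`differentiableOn_partialStandardL_of_norm_le_rpow`): the abscissa `n² + 2` of
`differentiableOn_partialStandardL_of_lt_re` improved to `(n+1)/2`; the half-plane `re s > 1` of
Jacquet–Shalika's Thm. (5.3) is reached this way exactly for `n = 1`. [folklore] -/
theorem differentiableOn_partialStandardL_of_half_lt_re (hn : 1 ≤ n) (P : CuspidalAutomorphicRepGL n K μ)
    {S : Set (HeightOneSpectrum (𝓞 K))} {α : SatakeFamily K} (hα : IsSatakeFamilyOf P S α) :
    DifferentiableOn ℂ (partialStandardL S α) {s : ℂ | ((n : ℝ) + 1) / 2 < s.re} ∧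
      ∀ s : ℂ, ((n : ℝ) + 1) / 2 < s.re → partialStandardL S α s ≠ 0 := by
  have h := differentiableOn_partialStandardL_of_norm_le_rpow (B := ((n : ℝ) - 1) / 2)
    (fun v hv => (hα.card_eq hv).le) (fun v hv a ha => hα.norm_le_rpow_sub_one_div_two hn hv ha)
  have he : ((n : ℝ) - 1) / 2 + 1 = ((n : ℝ) + 1) / 2 := by ring
  rw [he] at h
  exact h

end Abscissa

end Literature.NumberTheory.Automorphic
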